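import Literature.MathematicalPhysics.QuantumFieldTheory.Balaban1983to89.B5Positivity172Lattice
import Literature.MathematicalPhysics.QuantumFieldTheory.TorusChartCurlPrimitiveGrowth
import HarnessLib

/-!
# [BalabanImbrieJaffe1985] §7.3 p. 326: the gauge in which a small plaquette field has a small potential, on the tori `T^{(k)}`

T. Bałaban, J. Imbrie, A. Jaffe, *Renormalization of the Higgs model: minimizers, propagators and the stability of mean
field theory*, Commun. Math. Phys. **97** (1985) 299–329 [BalabanImbrieJaffe1985], p. 326 [PDF 28], after (7.3.2): *"Also,
by change of gauge u_k can be transformed in a local region Λ into a configuration of the form exp[ie_kηA], where A is smooth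
and small with estimates depending on Λ."*  The discrete-geometric content of this sentence for the UNIT lattice `T₁^{(k)}`
of the model of record (`Balaban1983to89.Setup`: `Site P k`, `PBond P k`, `Plaq P k`, plaquette variable
`LatticeFieldCalculus.curl 1`) is the Hodge decomposition of a CLOSED plaquette field with a potential whose size is
controlled by the `ℓ¹` torus distance `Site.tdist` to a chosen base site, uniformly in the volume:

* `plaqCoch G` — a plaquette field `G : Plaq P k → ℝ` (positively oriented plaquettes `μ < ν`) read as an alternating
  `2`-cochain on the charted torus `B5Positivity172Lattice.chart P k = TorusChart.pi d (2L^{m+K−k})`; `plaqCoch_curl`: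
  `∂_cB` reads as `c·d₁`; `IsClosedPlaq G` — the abelian Bianchi identity `dG = 0`, with the explicit cube criterion
  `isClosedPlaq_iff_cube` and `isClosedPlaq_curl`;
* `constPlaq h` — the constant plaquette fields (`h_{μν}` on every plaquette of type `(μν)`);
* distances: the chart box centred at `x₀` has `ℓ¹`-distance-to-centre = `Site.tdist · x₀` (`cdist_transl_eq_tdist`, every
  period `2L^{m+K−k}` being even), and the seam weight of `TorusChartCurlPrimitiveGrowth` is `≤ 4d(1 + tdist)²` there
  (`seamW_transl_le`);
* **`exists_const_add_curl_of_closed`**: every closed `G` with `|G| ≤ s` is `G(p) = h_{μν} + (∂₁B)(p)` with `|h_{μν}| ≤ s` and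
  `|B(b)| ≤ (8d + 2)·s·(1 + |b₋ − x₀|₁)²` for ANY base site `x₀` — from `TorusChart.exists_const₂_add_d₁_of_closed` translated
  so that `x₀` sits at the centre of the chart box.

Everything is proved (0 `sorry`, no new named fact); the statements are elementary and carry the locator of the sentence they
serve.  Phase-2 file of the lit-balaban typed skeleton, seat p30 gen 9 (row C1.Eq7.3.1-7.3.2, the located input `K_R` of
the residual field (4.2.6)).  statement-level skeleton of published theorems with citation tags; proofs where landed; nothing
here is a claim about the Yang–Mills mass gap.
-/

namespace Literature.MathematicalPhysics.QuantumFieldTheory.BalabanImbrieJaffe1984to88.BIJ85UnitTorusHodge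

open scoped BigOperators
open Literature.MathematicalPhysics.QuantumFieldTheory.Balaban1983to89
open LatticeFieldCalculus B5Positivity172Lattice

variable {P : Params} {j : ℕ}

/-! ## §1 Plaquette fields as alternating `2`-cochains -/

/-- A plaquette field (on positively oriented plaquettes `μ < ν`) read as an ALTERNATING `2`-cochain on the charted torus
`T^{(j)}` (`−G` on the reversed orientation, `0` on the diagonal). [cite: BalabanImbrieJaffe1985, §7.3 p.326] -/
def plaqCoch (G : Plaq P j → ℝ) : TT P j → Fin P.d → Fin P.d → ℝ := fun x μ ν =>
  if h : μ < ν then G ⟨ofT x, μ, ν, h⟩ else if h' : ν < μ then -G ⟨ofT x, ν, μ, h'⟩ else 0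

/-- `plaqCoch` on an increasing pair. [cite: BalabanImbrieJaffe1985, §7.3 p.326] -/
theorem plaqCoch_of_lt (G : Plaq P j → ℝ) (x : TT P j) {μ ν : Fin P.d} (h : μ < ν) :
    plaqCoch G x μ ν = G ⟨ofT x, μ, ν, h⟩ := by
  rw [plaqCoch, dif_pos h]

/-- `plaqCoch` on a decreasing pair. [cite: BalabanImbrieJaffe1985, §7.3 p.326] -/
theorem plaqCoch_of_gt (G : Plaq P j → ℝ) (x : TT P j) {μ ν : Fin P.d} (h : ν < μ) :
    plaqCoch G x μ ν = -G ⟨ofT x, ν, μ, h⟩ := by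
  rw [plaqCoch, dif_neg (lt_asymm h), dif_pos h]

/-- `plaqCoch` on the diagonal. [cite: BalabanImbrieJaffe1985, §7.3 p.326] -/
theorem plaqCoch_self (G : Plaq P j → ℝ) (x : TT P j) (μ : Fin P.d) : plaqCoch G x μ μ = 0 := by
  rw [plaqCoch, dif_neg (lt_irrefl _), dif_neg (lt_irrefl _)]

/-- `plaqCoch` read back on a plaquette. [cite: BalabanImbrieJaffe1985, §7.3 p.326] -/
theorem plaqCoch_plaq (G : Plaq P j → ℝ) (p : Plaq P j) : plaqCoch G (toT p.src) p.μ p.ν = G p := by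
  rw [plaqCoch_of_lt G _ p.hμν]

/-- `plaqCoch G` is alternating. [cite: BalabanImbrieJaffe1985, §7.3 p.326] -/
theorem isAlt₂_plaqCoch (G : Plaq P j → ℝ) : TorusChart.IsAlt₂ (plaqCoch G) := by
  refine ⟨fun x μ => plaqCoch_self G x μ, fun x μ ν => ?_⟩
  rcases lt_trichotomy μ ν with h | rfl | h
  · rw [plaqCoch_of_gt G x h, plaqCoch_of_lt G x h]
  · rw [plaqCoch_self, neg_zero]
  · rw [plaqCoch_of_lt G x h, plaqCoch_of_gt G x h, neg_neg]

/-- A bound on the plaquette field bounds its cochain. [cite: BalabanImbrieJaffe1985, §7.3 p.326] -/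
theorem abs_plaqCoch_le {G : Plaq P j → ℝ} {s : ℝ} (hs0 : 0 ≤ s) (hs : ∀ p, |G p| ≤ s) (x : TT P j) (μ ν : Fin P.d) :
    |plaqCoch G x μ ν| ≤ s := by
  rcases lt_trichotomy μ ν with h | rfl | h
  · rw [plaqCoch_of_lt G x h]; exact hs _
  · rw [plaqCoch_self, abs_zero]; exact hs0
  · rw [plaqCoch_of_gt G x h, abs_neg]; exact hs _

/-- `plaqCoch` is additive. [cite: BalabanImbrieJaffe1985, §7.3 p.326] -/
theorem plaqCoch_add (G G' : Plaq P j → ℝ) : plaqCoch (G + G') = plaqCoch G + plaqCoch G' := by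
  funext x μ ν
  rcases lt_trichotomy μ ν with h | rfl | h
  · simp only [Pi.add_apply, plaqCoch_of_lt _ x h]
  · simp only [Pi.add_apply, plaqCoch_self, add_zero]
  · simp only [Pi.add_apply, plaqCoch_of_gt _ x h, neg_add]

/-- **The plaquette variable reads as `c·d₁`** on the whole alternating cochain: `plaqCoch (∂_cB) = c·d₁ (coch B)`
(`B5Positivity172Lattice.curl_eq_d₁` on `μ < ν`, antisymmetry elsewhere). [cite: BalabanImbrieJaffe1985, §7.3 p.326] -/
theorem plaqCoch_curl (c : ℝ) (B : VecField P j ℝ) :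
    plaqCoch (curl c B) = fun x μ ν => c * (chart P j).d₁ (coch B) x μ ν := by
  funext x μ ν
  rcases lt_trichotomy μ ν with h | rfl | h
  · rw [plaqCoch_of_lt _ x h, curl_eq_d₁]
  · rw [plaqCoch_self, TorusChart.d₁_self, mul_zero]
  · rw [plaqCoch_of_gt _ x h, curl_eq_d₁, TorusChart.d₁_swap (chart P j) (coch B) x μ ν]
    show -(c * -(chart P j).d₁ (coch B) x μ ν) = _
    ring

/-! ## §2 Closed plaquette fields (the abelian Bianchi identity) -/

/-- **A plaquette field is CLOSED** (`dG = 0`): its alternating cochain has vanishing `d₂` on the charted torus.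
[cite: BalabanImbrieJaffe1985, §7.3 p.326] -/
def IsClosedPlaq (G : Plaq P j → ℝ) : Prop := (chart P j).d₂ (plaqCoch G) = 0

/-- For an alternating `2`-cochain on a charted torus, closedness on SORTED triples `i < j < k` is closedness (degenerate
triples by alternation, permuted ones up to sign). [cite: BalabanImbrieJaffe1985, §7.3 p.326] -/
theorem d₂_eq_zero_of_sorted {Λ : Type*} [AddCommGroup Λ] {d : ℕ} (F : TorusChart Λ d) {A : Type*} [AddCommGroup A]
    {ω : Λ → Fin d → Fin d → A} (halt : TorusChart.IsAlt₂ ω)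
    (h : ∀ (x : Λ) (i j k : Fin d), i < j → j < k → F.d₂ ω x i j k = 0) : F.d₂ ω = 0 := by
  funext x i j k
  rw [Pi.zero_apply, Pi.zero_apply, Pi.zero_apply, Pi.zero_apply]
  have hswap12 : ∀ y (i j k : Fin d), F.d₂ ω y j i k = -F.d₂ ω y i j k := by
    intro y i j k; simp only [TorusChart.d₂_apply]; rw [halt.swap y i j, halt.swap (y + F.gen k) i j]; abel
  have hswap23 : ∀ y (i j k : Fin d), F.d₂ ω y i k j = -F.d₂ ω y i j k := by
    intro y i j k; simp only [TorusChart.d₂_apply]; rw [halt.swap y j k, halt.swap (y + F.gen i) j k]; abel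
  have hdeg12 : ∀ y (i k : Fin d), F.d₂ ω y i i k = 0 := by
    intro y i k; simp only [TorusChart.d₂_apply, halt.diag]; abel
  have hdeg23 : ∀ y (i j : Fin d), F.d₂ ω y i j j = 0 := by
    intro y i j; simp only [TorusChart.d₂_apply, halt.diag]; abel
  have hdeg13 : ∀ y (i j : Fin d), F.d₂ ω y i j i = 0 := by
    intro y i j; rw [hswap23, hdeg12, neg_zero]
  rcases lt_trichotomy i j with hij | rfl | hij
  · rcases lt_trichotomy j k with hjk | rfl | hjk
    · exact h x i j k hij hjk
    · exact hdeg23 x i j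
    · rcases lt_trichotomy i k with hik | rfl | hik
      · rw [hswap23, h x i k j hik hjk, neg_zero]
      · exact hdeg13 x i j
      · rw [hswap23, hswap12, h x k i j hik hij, neg_zero, neg_zero]
  · exact hdeg12 x i k
  · rcases lt_trichotomy i k with hik | rfl | hik
    · rw [hswap12, h x j i k hij hik, neg_zero]
    · exact hdeg13 x i j
    · rcases lt_trichotomy j k with hjk | rfl | hjk
      · rw [hswap12, hswap23, h x j k i hjk hik, neg_zero, neg_zero]
      · exact hdeg23 x i j
      · rw [hswap12, hswap23, hswap12, h x k j i hjk hij, neg_neg, neg_zero]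

/-- The `d₂` of a plaquette field on a sorted triple `μ < ν < ρ`, in plaquette terms: the oriented sum of `G` over the six
faces of the unit cube at `x` spanned by `e_μ, e_ν, e_ρ`. [cite: BalabanImbrieJaffe1985, §7.3 p.326] -/
theorem d₂_plaqCoch_sorted (G : Plaq P j → ℝ) (x : Balaban1983to89.Site P j) {μ ν ρ : Fin P.d} (h1 : μ < ν)
    (h2 : ν < ρ) :
    (chart P j).d₂ (plaqCoch G) (toT x) μ ν ρ =
      (G ⟨x.shift μ, ν, ρ, h2⟩ - G ⟨x, ν, ρ, h2⟩) - (G ⟨x.shift ν, μ, ρ, h1.trans h2⟩ - G ⟨x, μ, ρ, h1.trans h2⟩)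
        + (G ⟨x.shift ρ, μ, ν, h1⟩ - G ⟨x, μ, ν, h1⟩) := by
  simp only [TorusChart.d₂_apply, plaqCoch_of_lt _ _ h1, plaqCoch_of_lt _ _ h2, plaqCoch_of_lt _ _ (h1.trans h2),
    shift_eq]

/-- **The cube criterion**: `G` is closed iff the oriented sum of `G` over the faces of every unit cube vanishes (sorted
triples `μ < ν < ρ` suffice). [cite: BalabanImbrieJaffe1985, §7.3 p.326] -/
theorem isClosedPlaq_iff_cube (G : Plaq P j → ℝ) :
    IsClosedPlaq G ↔ ∀ (x : Balaban1983to89.Site P j) (μ ν ρ : Fin P.d) (h1 : μ < ν) (h2 : ν < ρ),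
      (G ⟨x.shift μ, ν, ρ, h2⟩ - G ⟨x, ν, ρ, h2⟩) - (G ⟨x.shift ν, μ, ρ, h1.trans h2⟩ - G ⟨x, μ, ρ, h1.trans h2⟩)
        + (G ⟨x.shift ρ, μ, ν, h1⟩ - G ⟨x, μ, ν, h1⟩) = 0 := by
  constructor
  · intro hG x μ ν ρ h1 h2
    rw [← d₂_plaqCoch_sorted G x h1 h2]
    have := congr_fun (congr_fun (congr_fun (congr_fun hG (toT x)) μ) ν) ρ
    exact this
  · intro h
    refine d₂_eq_zero_of_sorted (chart P j) (isAlt₂_plaqCoch G) fun x μ ν ρ h1 h2 => ?_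
    rw [show x = toT (ofT x) from rfl, d₂_plaqCoch_sorted G (ofT x) h1 h2]
    exact h (ofT x) μ ν ρ h1 h2

/-- **Plaquette variables are closed**: `d(∂_cB) = 0` (`d₂ ∘ d₁ = 0`). [cite: BalabanImbrieJaffe1985, §7.3 p.326] -/
theorem isClosedPlaq_curl (c : ℝ) (B : VecField P j ℝ) : IsClosedPlaq (curl c B) := by
  unfold IsClosedPlaq
  rw [plaqCoch_curl]
  have h0 := (chart P j).d₂_d₁ (coch B)
  funext x μ ν ρ
  have h := congr_fun (congr_fun (congr_fun (congr_fun h0 x) μ) ν) ρ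
  simp only [TorusChart.d₂_apply, Pi.zero_apply] at h ⊢
  calc _ = c * ((chart P j).d₁ (coch B) (x + (chart P j).gen μ) ν ρ - (chart P j).d₁ (coch B) x ν ρ -
        ((chart P j).d₁ (coch B) (x + (chart P j).gen ν) μ ρ - (chart P j).d₁ (coch B) x μ ρ) +
        ((chart P j).d₁ (coch B) (x + (chart P j).gen ρ) μ ν - (chart P j).d₁ (coch B) x μ ν)) := by ring
    _ = 0 := by rw [h, mul_zero]

/-- Closed plaquette fields form an additive class. [cite: BalabanImbrieJaffe1985, §7.3 p.326] -/
theorem IsClosedPlaq.add {G G' : Plaq P j → ℝ} (hG : IsClosedPlaq G) (hG' : IsClosedPlaq G') : IsClosedPlaq (G + G') := by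
  unfold IsClosedPlaq at *
  rw [plaqCoch_add, TorusChart.d₂_add, hG, hG', add_zero]

/-! ## §3 Constant plaquette fields -/

/-- The **constant plaquette field** with value `h μ ν` on every plaquette of type `(μν)`. [cite: BalabanImbrieJaffe1985, §7.3 p.326] -/
def constPlaq (h : Fin P.d → Fin P.d → ℝ) : Plaq P j → ℝ := fun p => h p.μ p.ν

/-- Unfolding `constPlaq`. [cite: BalabanImbrieJaffe1985, §7.3 p.326] -/
@[simp] theorem constPlaq_apply (h : Fin P.d → Fin P.d → ℝ) (p : Plaq P j) : constPlaq h p = h p.μ p.ν := rfl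

/-- The cochain of a constant plaquette field does not depend on the site. [cite: BalabanImbrieJaffe1985, §7.3 p.326] -/
theorem plaqCoch_constPlaq (h : Fin P.d → Fin P.d → ℝ) (x y : TT P j) (μ ν : Fin P.d) :
    plaqCoch (constPlaq h : Plaq P j → ℝ) x μ ν = plaqCoch (constPlaq h : Plaq P j → ℝ) y μ ν := by
  rcases lt_trichotomy μ ν with hl | rfl | hl
  · rw [plaqCoch_of_lt _ x hl, plaqCoch_of_lt _ y hl]; rfl
  · rw [plaqCoch_self, plaqCoch_self]
  · rw [plaqCoch_of_gt _ x hl, plaqCoch_of_gt _ y hl]; rfl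

/-- **Constant plaquette fields are closed.** [cite: BalabanImbrieJaffe1985, §7.3 p.326] -/
theorem isClosedPlaq_constPlaq (h : Fin P.d → Fin P.d → ℝ) : IsClosedPlaq (constPlaq h : Plaq P j → ℝ) := by
  unfold IsClosedPlaq
  funext x μ ν ρ
  simp only [TorusChart.d₂_apply, Pi.zero_apply, plaqCoch_constPlaq h (x + _) x, sub_self, add_zero]

/-- For an alternating value `h` the cochain of `constPlaq h` is the constant cochain `const₂ h`. [cite: BalabanImbrieJaffe1985, §7.3 p.326] -/
theorem plaqCoch_constPlaq_eq_const₂ {h : Fin P.d → Fin P.d → ℝ} (h0 : ∀ μ, h μ μ = 0) (hsw : ∀ μ ν, h ν μ = -h μ ν) :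
    plaqCoch (constPlaq h : Plaq P j → ℝ) = (chart P j).const₂ h := by
  funext x μ ν
  rw [TorusChart.const₂_apply]
  rcases lt_trichotomy μ ν with hl | rfl | hl
  · rw [plaqCoch_of_lt _ x hl]; rfl
  · rw [plaqCoch_self, h0]
  · rw [plaqCoch_of_gt _ x hl, constPlaq_apply, ← hsw]

/-! ## §4 The chart centred at a base site: distances -/

variable (P j) in
/-- The **centre of the chart box**: all coordinates `N/2`, `N = 2L^{m+K−j}`. [cite: BalabanImbrieJaffe1985, §7.3 p.326] -/
def ctr : TT P j := fun _ => ((P.sitesPerDir j / 2 : ℕ) : ZMod (P.sitesPerDir j))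

/-- Every period of the tori of the series is even: `N = 2·(N/2)`. [cite: BalabanImbrieJaffe1985, §7.3 p.326] -/
theorem sitesPerDir_eq_two_mul (P : Params) (j : ℕ) : P.sitesPerDir j = 2 * (P.sitesPerDir j / 2) := by
  unfold Params.sitesPerDir; omega

/-- The key residue computation: on `ℤ/2M`, `|(z + M) mod 2M − M| = min(z mod 2M, (−z) mod 2M)` — shifting by half a period
turns the chart coordinate's distance to the centre into the torus distance to `0`. [cite: BalabanImbrieJaffe1985, §7.3 p.326] -/
theorem abs_val_add_half_sub_half {N : ℕ} [NeZero N] {M : ℕ} (hN : N = 2 * M) (z : ZMod N) :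
    |(((z + (M : ZMod N)).val : ℕ) : ℝ) - M| = (min z.val (-z).val : ℕ) := by
  have hM : 0 < M := by
    rcases Nat.eq_zero_or_pos M with h | h
    · exact absurd (by omega : N = 0) (NeZero.ne N)
    · exact h
  have hMN : M < N := by omega
  have hvM : (M : ZMod N).val = M := ZMod.val_natCast_of_lt hMN
  have hv : (z + (M : ZMod N)).val = (z.val + M) % N := by rw [ZMod.val_add, hvM]
  have hz : z.val < N := ZMod.val_lt z
  rw [hv, ZMod.neg_val]
  by_cases hlt : z.val < M
  · rw [Nat.mod_eq_of_lt (by omega)]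
    split_ifs with h0
    · rw [h0, ZMod.val_zero]; simp
    · have h0' : z.val ≠ 0 := fun h => h0 ((ZMod.val_eq_zero z).1 h)
      rw [min_eq_left (by omega)]
      push_cast
      rw [add_sub_cancel_right, Nat.abs_cast]
  · have hge : M ≤ z.val := not_lt.1 hlt
    have hmod : (z.val + M) % N = z.val + M - N := by
      rw [Nat.mod_eq_sub_mod (by omega), Nat.mod_eq_of_lt (by omega)]
    rw [hmod]
    have h0 : z ≠ 0 := fun h => by rw [h, ZMod.val_zero] at hge; omega
    rw [if_neg h0, min_eq_right (by omega)]
    have h1 : ((z.val + M - N : ℕ) : ℝ) - M = -((N - z.val : ℕ) : ℝ) := by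
      rw [Nat.cast_sub (by omega), Nat.cast_sub hz.le, Nat.cast_add]
      ring
    rw [h1, abs_neg, Nat.abs_cast]

/-- **The `ℓ¹` distance to the centre of the chart, after the translation taking `x₀` to the centre, is the torus distance
`|x − x₀|₁` of `Setup` (`Site.tdist`).** [cite: BalabanImbrieJaffe1985, §7.3 p.326] -/
theorem cdist_transl_eq_tdist (x x₀ : Balaban1983to89.Site P j) :
    (chart P j).cdist (toT x - toT x₀ + ctr P j) = (x.tdist x₀ : ℝ) := by
  unfold TorusChart.cdist Site.tdist
  push_cast
  refine Finset.sum_congr rfl fun κ _ => ?_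
  simp only [TorusChart.pi_cval, TorusChart.pi_period, ctr, Pi.add_apply, Pi.sub_apply]
  rw [abs_val_add_half_sub_half (sitesPerDir_eq_two_mul P j) (toT x κ - toT x₀ κ), neg_sub, Nat.cast_min]

/-- On the last `μ`-layer of the centred chart the torus distance to `x₀` is at least `N/2 − 1`, i.e. `N ≤ 2·tdist + 2`.
[cite: BalabanImbrieJaffe1985, §7.3 p.326] -/
theorem sitesPerDir_le_of_seam {x x₀ : Balaban1983to89.Site P j} {μ : Fin P.d}
    (hx : (chart P j).cval μ (toT x - toT x₀ + ctr P j) + 1 = (chart P j).period μ) :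
    (P.sitesPerDir j : ℝ) ≤ 2 * (x.tdist x₀ : ℝ) + 2 := by
  have hsum := cdist_transl_eq_tdist x x₀
  unfold TorusChart.cdist at hsum
  have hterm : |(((chart P j).cval μ (toT x - toT x₀ + ctr P j) : ℕ) : ℝ) - ((chart P j).period μ / 2 : ℕ)| ≤
      (x.tdist x₀ : ℝ) := by
    rw [← hsum]
    exact Finset.single_le_sum (f := fun κ => |(((chart P j).cval κ (toT x - toT x₀ + ctr P j) : ℕ) : ℝ) -
      ((chart P j).period κ / 2 : ℕ)|) (fun κ _ => abs_nonneg _) (Finset.mem_univ μ)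
  simp only [TorusChart.pi_period] at hterm hx
  have h2 := sitesPerDir_eq_two_mul P j
  have hc : ((chart P j).cval μ (toT x - toT x₀ + ctr P j) : ℝ) = (P.sitesPerDir j : ℝ) - 1 := by
    have : (chart P j).cval μ (toT x - toT x₀ + ctr P j) = P.sitesPerDir j - 1 := by omega
    rw [this, Nat.cast_sub (by have := NeZero.pos (P.sitesPerDir j); omega), Nat.cast_one]
  rw [hc] at hterm
  have hhalf : (((P.sitesPerDir j / 2 : ℕ)) : ℝ) = (P.sitesPerDir j : ℝ) / 2 := by
    rw [eq_div_iff (two_ne_zero), mul_comm]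
    exact_mod_cast h2.symm
  rw [hhalf] at hterm
  have := (abs_le.1 hterm).2
  linarith

/-- **The seam weight after the centring translation is at most `4d(1 + |x − x₀|₁)²`** (it lives on the last layers only,
where `N ≤ 2|x − x₀|₁ + 2`, and is `≤ (Σ_i x_i)·N ≤ dN²` there). [cite: BalabanImbrieJaffe1985, §7.3 p.326] -/
theorem seamW_transl_le (x x₀ : Balaban1983to89.Site P j) (μ : Fin P.d) :
    (chart P j).seamW (toT x - toT x₀ + ctr P j) μ ≤ 4 * P.d * (1 + (x.tdist x₀ : ℝ)) ^ 2 := by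
  unfold TorusChart.seamW
  split_ifs with hx
  · have hN := sitesPerDir_le_of_seam hx
    have hN0 : (0 : ℝ) ≤ P.sitesPerDir j := Nat.cast_nonneg _
    simp only [TorusChart.pi_period, TorusChart.pi_cval]
    have hsum : (∑ i : Fin P.d, (((toT x - toT x₀ + ctr P j) i).val : ℝ)) ≤ P.d * (P.sitesPerDir j : ℝ) := by
      have h1 : ∀ i ∈ (Finset.univ : Finset (Fin P.d)), (((toT x - toT x₀ + ctr P j) i).val : ℝ) ≤ P.sitesPerDir j :=
        fun i _ => by exact_mod_cast (ZMod.val_lt _).le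
      refine (Finset.sum_le_card_nsmul _ _ _ h1).trans (le_of_eq ?_)
      rw [Finset.card_univ, Fintype.card_fin, nsmul_eq_mul]
    have ht : (0 : ℝ) ≤ (x.tdist x₀ : ℝ) := Nat.cast_nonneg _
    calc (∑ i : Fin P.d, (((toT x - toT x₀ + ctr P j) i).val : ℝ)) * (P.sitesPerDir j : ℝ)
        ≤ P.d * (P.sitesPerDir j : ℝ) * (P.sitesPerDir j : ℝ) := mul_le_mul_of_nonneg_right hsum hN0
      _ ≤ P.d * (2 * (x.tdist x₀ : ℝ) + 2) * (2 * (x.tdist x₀ : ℝ) + 2) := by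
          have hd : (0 : ℝ) ≤ P.d := Nat.cast_nonneg _
          have := mul_le_mul hN hN hN0 (by linarith)
          nlinarith
      _ = 4 * P.d * (1 + (x.tdist x₀ : ℝ)) ^ 2 := by ring
  · positivity

/-! ## §5 The decomposition: constant part plus the curl of a potential of controlled growth -/

/-- `d₂` commutes with translations. [cite: BalabanImbrieJaffe1985, §7.3 p.326] -/
theorem d₂_transl {Λ : Type*} [AddCommGroup Λ] {d : ℕ} (F : TorusChart Λ d) {A : Type*} [AddCommGroup A]
    (ω : Λ → Fin d → Fin d → A) (v : Λ) :
    F.d₂ (fun x => ω (x + v)) = fun x i l k => F.d₂ ω (x + v) i l k := by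
  funext x i l k
  simp only [TorusChart.d₂_apply, add_right_comm x _ v]

/-- **THE GAUGE OF p. 326 ON THE UNIT TORUS.**  Every CLOSED plaquette field `G` on `T^{(j)}` with `|G(p)| ≤ s` is a constant
plaquette field plus a plaquette variable, `G(p) = h_{μν} + (∂₁B)(p)`, where `|h_{μν}| ≤ s` and the potential `B` is small near
the chosen base site `x₀` and grows at most quadratically in the `ℓ¹` torus distance from it,
`|B(b)| ≤ (8d + 2)·s·(1 + |b₋ − x₀|₁)²`, uniformly in the volume (*"by change of gauge … exp[ie_kηA], where A is smooth and
small with estimates depending on Λ"*). [cite: BalabanImbrieJaffe1985, §7.3 p.326] -/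
theorem exists_const_add_curl_of_closed {G : Plaq P j → ℝ} (hG : IsClosedPlaq G) {s : ℝ} (hs0 : 0 ≤ s)
    (hs : ∀ p, |G p| ≤ s) (x₀ : Balaban1983to89.Site P j) :
    ∃ (h : Fin P.d → Fin P.d → ℝ) (B : VecField P j ℝ), (∀ μ ν, |h μ ν| ≤ s) ∧ (∀ μ, h μ μ = 0) ∧
      (∀ μ ν, h ν μ = -h μ ν) ∧ (∀ p, G p = h p.μ p.ν + curl 1 B p) ∧
      ∀ b : PBond P j, |B b| ≤ (8 * P.d + 2) * s * (1 + (b.src.tdist x₀ : ℝ)) ^ 2 := by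
  -- translate so that `x₀` sits at the centre of the chart box
  set v : TT P j := toT x₀ - ctr P j with hv
  set q : TT P j → Fin P.d → Fin P.d → ℝ := fun y => plaqCoch G (y + v) with hq
  have halt : TorusChart.IsAlt₂ q :=
    ⟨fun y μ => (isAlt₂_plaqCoch G).diag _ μ, fun y μ ν => (isAlt₂_plaqCoch G).swap _ μ ν⟩
  have hcl : (chart P j).d₂ q = 0 := by
    rw [hq, d₂_transl]
    funext y i l k
    have := congr_fun (congr_fun (congr_fun (congr_fun hG (y + v)) i) l) k
    exact this
  have hqs : ∀ y μ ν, |q y μ ν| ≤ s := fun y μ ν => abs_plaqCoch_le hs0 hs _ μ ν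
  obtain ⟨θ, hθ, hb⟩ := TorusChart.exists_const₂_add_d₁_of_closed halt hcl hqs
  refine ⟨(chart P j).fluxAvg q, fun b => θ (toT b.src - v) b.dir, fun μ ν => (chart P j).abs_fluxAvg_le q hqs μ ν,
    (chart P j).fluxAvg_self halt, (chart P j).fluxAvg_swap halt, fun p => ?_, fun b => ?_⟩
  · -- read the decomposition back on the plaquette `p`
    have h1 : G p = q (toT p.src - v) p.μ p.ν := by
      rw [hq]
      show G p = plaqCoch G (toT p.src - v + v) p.μ p.ν
      rw [sub_add_cancel, plaqCoch_plaq]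
    have h2 : curl 1 (fun b : PBond P j => θ (toT b.src - v) b.dir) p = (chart P j).d₁ θ (toT p.src - v) p.μ p.ν := by
      rw [curl_eq_d₁, one_mul]
      simp only [TorusChart.d₁_apply, coch_apply, add_sub_right_comm]
    rw [h1, h2]
    have := congr_fun (congr_fun (congr_fun hθ (toT p.src - v)) p.μ) p.ν
    rw [this, Pi.add_apply, Pi.add_apply, Pi.add_apply, TorusChart.const₂_apply]
  · -- the growth bound, read through the centring translation
    have h1 := hb (toT b.src - v) b.dir
    have heq : toT b.src - v = toT b.src - toT x₀ + ctr P j := by rw [hv]; abel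
    rw [heq, cdist_transl_eq_tdist] at h1
    show |θ (toT b.src - v) b.dir| ≤ _
    rw [heq]
    have h2 := seamW_transl_le b.src x₀ b.dir
    have ht : (0 : ℝ) ≤ (b.src.tdist x₀ : ℝ) := Nat.cast_nonneg _
    have hd : (0 : ℝ) ≤ P.d := Nat.cast_nonneg _
    calc |θ (toT b.src - toT x₀ + ctr P j) b.dir|
        ≤ 2 * s * ((b.src.tdist x₀ : ℝ) + (chart P j).seamW (toT b.src - toT x₀ + ctr P j) b.dir) := h1
      _ ≤ 2 * s * ((1 + (b.src.tdist x₀ : ℝ)) ^ 2 + 4 * P.d * (1 + (b.src.tdist x₀ : ℝ)) ^ 2) := by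
          refine mul_le_mul_of_nonneg_left (add_le_add ?_ h2) (by positivity)
          nlinarith
      _ = (8 * P.d + 2) * s * (1 + (b.src.tdist x₀ : ℝ)) ^ 2 := by ring

end Literature.MathematicalPhysics.QuantumFieldTheory.BalabanImbrieJaffe1984to88.BIJ85UnitTorusHodge
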